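import Mathlib
import Summits.Ventures.HodgeRepro.Tier4.Line4.TailSeesawFull
import Summits.Ventures.HodgeRepro.Tier4.Line4.FinNVInstance

/-!
# Tier4/Line4/TailSeesawFinNV — C-L4-7B-ASSEMBLY at the plane of record with (S-FIN-NV) BY NAME: the (7b) display
body at the product `Z(k)`-domain `torusFinSplit⁻¹(univ ×ˢ DA)`, modulo the display `haway` and `ChainInputs`

Blind re-derivation cell `pub-hodge-repro`, Tier 4 «prove the step» (README §9–§10), seat t4-L2-p2 (gen 5; C-L4-7B-ASSEMBLY
S15841, the binding of L4-x2's FinNVInstance offered in S15923 (a) / accepted S15931).  Tree path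
`lean/Summits/Ventures/HodgeRepro/Tier4/Line4/TailSeesawFinNV.lean`.  Imports this seat's `Line4/TailSeesawFull`
(`tailForArch_seesaw_of_pieces_full`) and L4-x2's `Line4/FinNVInstance` (`finnv_of_displays'`; through it
`measurableSet_preimage_torusFinSplit_prod`, `awayOrbital`).  Mathlib-level; no literature; no `def`.

**`tailForArch_seesaw_of_pieces_finnv`**: `tailForArch_seesaw_of_pieces_full` with the `Z(k)`-domain SPECIALISED to the
product domain of record `DZ_f := torusFinSplit⁻¹(univ ×ˢ DA)` (`DZ_S = T_S`, `DZ^{(S)} = DA`; AwayDomain) and the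
(S-FIN-NV) hypothesis `hnv` DISCHARGED by name: `finnv_of_displays'` (the fibre-compactness pair of PHASE-AT-P drawn
inside from `hdet`, `hgen`, `hlin`, `hDZc` — L4-p1's LevelFibreCompact) with `hv` from UnitBeta (`suppMeasure_toReal_pos_of_beta`)
and `hint`/`hB` from the `ChainInputs` of the admissible pair `(finf, e)` — the test `e` being ARCHAPPROX's, obtained inside
the `finf`-scope (the norm-form statement does not depend on `finf`, so it serves the full assembly at that `finf`).
THE RESIDUAL (the (7b) census at this layer): `ht`, `hdet`, the two `CompactSpace` instances, the Haar normalisations, the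
product-domain data `DA hDA hfd hDZc` (AwayDomain / AwayDomainRow), the level prime `p hp hγ₀`, the (F) pieces
`u κ hκ hproj M₃ hM₃ hcur`, (S-COUNT) `hcount`, the K-type data `D`, (S-FIN-NV)'s display `haway` (the away point of
the `γ₀`-existence display), and `ChainInputs` for every admissible
`(finf, e)` (`hchain`).

Nothing here says anything about the status of the Hodge conjecture for CM abelian varieties, which is NOT proved
(HC_CM is NOT proved by anyone in this repository).
-/

set_option autoImplicit false

noncomputable section

namespace Summit.Ventures.HodgeRepro.Tier4.Line4

open Matrix MeasureTheory Topology Filter NumberField IsDedekindDomain Summit.Ventures.HodgeRepro.Tier4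
  Summit.Ventures.HodgeRepro.Tier4.Common Summit.Ventures.HodgeRepro.Tier4.Line1
  Summit.Ventures.HodgeRepro.Tier4.Line1.RTF Summit.Ventures.HodgeRepro.Tier4.Line4.L1Class

open scoped NumberField NNReal ENNReal Pointwise Matrix

section FinNV

variable {k : Type} [Field k] [NumberField k]

/-- **The (7b) display body at the plane of record, (S-FIN-NV) by name at the product `Z(k)`-domain of record.** -/
theorem tailForArch_seesaw_of_pieces_finnv (q : QuadData k) (ht : q.t = 0) (hn : ¬ IsSquare (-q.n))
    (a : Fin 4 → k) (ha : ∀ i, a i ≠ 0)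
    (g g' : Matrix (Fin 4) (Fin 4) k) (hgg' : g * g' = 1) (hg'g : g' * g = 1)
    (hgΩ : g * (PlaneData.mixedRow q (a 0) (a 2)).Ω = (PlaneData.mixedRow q (a 0) (a 2)).Ω * g)
    (lam : k) (hlam : lam ≠ 0)
    (hiso : g * (PlaneData.mixedRow q (a 1) (a 3)).B * gᵀ = lam • (PlaneData.mixedRow q (a 0) (a 2)).B)
    (hdet : (((PlaneData.mixedRow q (a 0) (a 2)).withTransportedTorus g g' hgg' hg'g hgΩ)).B.det ≠ 0)
    [MeasurableSpace (GA ((PlaneData.mixedRow q (a 0) (a 2)).withTransportedTorus g g' hgg' hg'g hgΩ))] [BorelSpace (GA ((PlaneData.mixedRow q (a 0) (a 2)).withTransportedTorus g g' hgg' hg'g hgΩ))] [MeasurableMul (torusT ((PlaneData.mixedRow q (a 0) (a 2)).withTransportedTorus g g' hgg' hg'g hgΩ))] [MeasurableMul (torusT' ((PlaneData.mixedRow q (a 0) (a 2)).withTransportedTorus g g' hgg' hg'g hgΩ))]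
    (R : RTFData ((PlaneData.mixedRow q (a 0) (a 2)).withTransportedTorus g g' hgg' hg'g hgΩ)) (hRH : R.IsHaar)
    (hc : Continuous R.chi) (hu : ∀ a, ‖R.chi a‖ = 1) (hc' : Continuous R.chi') (hu' : ∀ a, ‖R.chi' a‖ = 1)
    (w₀ : InfinitePlace k) (eP eM eP' eM' : InfinitePlace k → ℤ)
    (D : KTypeData ((PlaneData.mixedRow q (a 0) (a 2)).withTransportedTorus g g' hgg' hg'g hgΩ) R q g g' eP eM eP' eM')
    [R.μT.IsHaarMeasure] [R.μT'.IsHaarMeasure]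
    (μ : Measure (GA ((PlaneData.mixedRow q (a 0) (a 2)).withTransportedTorus g g' hgg' hg'g hgΩ))) [μ.IsHaarMeasure] (DG : Set (GA ((PlaneData.mixedRow q (a 0) (a 2)).withTransportedTorus g g' hgg' hg'g hgΩ))) (fdG : IsFundamentalDomain (rationalPoints ((PlaneData.mixedRow q (a 0) (a 2)).withTransportedTorus g g' hgg' hg'g hgΩ)) DG μ)
    (compG : IsCompact (closure DG)) (compT : IsCompact (closure R.DT)) (compT' : IsCompact (closure R.DT'))
    (γ₀ : rationalPoints ((PlaneData.mixedRow q (a 0) (a 2)).withTransportedTorus g g' hgg' hg'g hgΩ)) (hlin : IsLinRegular ((PlaneData.mixedRow q (a 0) (a 2)).withTransportedTorus g g' hgg' hg'g hgΩ) γ₀)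
    (νinf : Measure (torusInf ((PlaneData.mixedRow q (a 0) (a 2)).withTransportedTorus g g' hgg' hg'g hgΩ))) [νinf.IsHaarMeasure] [CompactSpace (torusInf ((PlaneData.mixedRow q (a 0) (a 2)).withTransportedTorus g g' hgg' hg'g hgΩ))]
    (νf : Measure (torusFin ((PlaneData.mixedRow q (a 0) (a 2)).withTransportedTorus g g' hgg' hg'g hgΩ))) [νf.IsHaarMeasure]
    (c : ℝ≥0) (hc0 : 0 < c) (hcμ : R.μT = c • Measure.map (torusSplit ((PlaneData.mixedRow q (a 0) (a 2)).withTransportedTorus g g' hgg' hg'g hgΩ)).symm (νinf.prod νf))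
    (νinf' : Measure (torusInf' ((PlaneData.mixedRow q (a 0) (a 2)).withTransportedTorus g g' hgg' hg'g hgΩ))) [νinf'.IsHaarMeasure] [CompactSpace (torusInf' ((PlaneData.mixedRow q (a 0) (a 2)).withTransportedTorus g g' hgg' hg'g hgΩ))]
    (νf' : Measure (torusFin' ((PlaneData.mixedRow q (a 0) (a 2)).withTransportedTorus g g' hgg' hg'g hgΩ))) [νf'.IsHaarMeasure]
    (c' : ℝ≥0) (hc0' : 0 < c') (hcμ' : R.μT' = c' • Measure.map (torusSplit' ((PlaneData.mixedRow q (a 0) (a 2)).withTransportedTorus g g' hgg' hg'g hgΩ)).symm (νinf'.prod νf'))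
    (p : ℕ) (hp : p.Prime)
    (hγ₀ : ∀ v : HeightOneSpectrum (𝓞 k), natSize k v p < 1 → ∀ i j : Fin 4,
      Valued.v (finPart k (GA.mat ((PlaneData.mixedRow q (a 0) (a 2)).withTransportedTorus g g' hgg' hg'g hgΩ) (γ₀ : GA ((PlaneData.mixedRow q (a 0) (a 2)).withTransportedTorus g g' hgg' hg'g hgΩ)) i j) v) ≤ 1 ∧ Valued.v (finPart k (GA.mat ((PlaneData.mixedRow q (a 0) (a 2)).withTransportedTorus g g' hgg' hg'g hgΩ) (γ₀ : GA ((PlaneData.mixedRow q (a 0) (a 2)).withTransportedTorus g g' hgg' hg'g hgΩ))⁻¹ i j) v) ≤ 1)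
    -- the product `Z(k)`-domain of record `torusFinSplit⁻¹(univ ×ˢ DA)` (AwayDomain) and its fundamental-domain /
    -- compactness data (ZDOMAIN-EX (iv) at the product domain); the away measures and (S-FIN-NV)'s display `haway`
    (νA : Measure (torusFinAway ((PlaneData.mixedRow q (a 0) (a 2)).withTransportedTorus g g' hgg' hg'g hgΩ) (placesAbove (k := k) p))) [νA.IsHaarMeasure]
    (νA' : Measure (torusFinAway' ((PlaneData.mixedRow q (a 0) (a 2)).withTransportedTorus g g' hgg' hg'g hgΩ) (placesAbove (k := k) p))) [νA'.IsHaarMeasure]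
    (DA : Set (torusFinAway ((PlaneData.mixedRow q (a 0) (a 2)).withTransportedTorus g g' hgg' hg'g hgΩ) (placesAbove (k := k) p))) (hDA : MeasurableSet DA)
    (hfd : IsFundamentalDomain (centreFin ((PlaneData.mixedRow q (a 0) (a 2)).withTransportedTorus g g' hgg' hg'g hgΩ)) ((torusFinSplit ((PlaneData.mixedRow q (a 0) (a 2)).withTransportedTorus g g' hgg' hg'g hgΩ) (placesAbove (k := k) p)) ⁻¹' (Set.univ ×ˢ DA)) νf)
    (hDZc : ∀ C : Set (torusFin ((PlaneData.mixedRow q (a 0) (a 2)).withTransportedTorus g g' hgg' hg'g hgΩ)), IsCompact C → IsCompact (closure (((torusFinSplit ((PlaneData.mixedRow q (a 0) (a 2)).withTransportedTorus g g' hgg' hg'g hgΩ) (placesAbove (k := k) p)) ⁻¹' (Set.univ ×ˢ DA)) ∩ (C * (ZfIn ((PlaneData.mixedRow q (a 0) (a 2)).withTransportedTorus g g' hgg' hg'g hgΩ) : Set (torusFin ((PlaneData.mixedRow q (a 0) (a 2)).withTransportedTorus g g' hgg' hg'g hgΩ)))))))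
    (haway : awayOrbital ((PlaneData.mixedRow q (a 0) (a 2)).withTransportedTorus g g' hgg' hg'g hgΩ) (placesAbove (k := k) p) R (γ₀ : GA ((PlaneData.mixedRow q (a 0) (a 2)).withTransportedTorus g g' hgg' hg'g hgΩ)) νA νA' DA ≠ 0)
    (μinf : Measure (infinitePart ((PlaneData.mixedRow q (a 0) (a 2)).withTransportedTorus g g' hgg' hg'g hgΩ))) [μinf.IsHaarMeasure] (μ₀ : Measure (finitePart ((PlaneData.mixedRow q (a 0) (a 2)).withTransportedTorus g g' hgg' hg'g hgΩ))) [μ₀.IsHaarMeasure]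
    (c₀ : ℝ≥0) (hc₀ : 0 < c₀) (hcμ₀ : μ = c₀ • Measure.map (gaSplit ((PlaneData.mixedRow q (a 0) (a 2)).withTransportedTorus g g' hgg' hg'g hgΩ)).symm (μinf.prod μ₀))
    (u : ℕ → ℝ≥0∞) (κ : ℝ≥0∞) (hκ : κ ≠ ⊤)
    (hproj : ∀ (M : ℕ) (γ : GA ((PlaneData.mixedRow q (a 0) (a 2)).withTransportedTorus g g' hgg' hg'g hgΩ)), νf (finTf ((PlaneData.mixedRow q (a 0) (a 2)).withTransportedTorus g g' hgg' hg'g hgΩ) '' closure R.DT ∩ projSet ((PlaneData.mixedRow q (a 0) (a 2)).withTransportedTorus g g' hgg' hg'g hgΩ) (γ₀ : GA ((PlaneData.mixedRow q (a 0) (a 2)).withTransportedTorus g g' hgg' hg'g hgΩ)) (p ^ M) γ) ≤ κ * u M)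
    (M₃ : ℝ≥0∞) (hM₃ : M₃ ≠ ⊤)
    (hcur : ∀ M, u M ≤ M₃ * νf (((ZfIn ((PlaneData.mixedRow q (a 0) (a 2)).withTransportedTorus g g' hgg' hg'g hgΩ) : Set (torusFin ((PlaneData.mixedRow q (a 0) (a 2)).withTransportedTorus g g' hgg' hg'g hgΩ))) ∩ levelTf ((PlaneData.mixedRow q (a 0) (a 2)).withTransportedTorus g g' hgg' hg'g hgΩ) 1) * levelTf ((PlaneData.mixedRow q (a 0) (a 2)).withTransportedTorus g g' hgg' hg'g hgΩ) (p ^ M)))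
    (hcount : SublevelCount₀ ((PlaneData.mixedRow q (a 0) (a 2)).withTransportedTorus g g' hgg' hg'g hgΩ) (Setting.ofAdelicData ((PlaneData.mixedRow q (a 0) (a 2)).withTransportedTorus g g' hgg' hg'g hgΩ) R μ DG fdG compG compT compT'))
    -- `ChainInputs` for every admissible `(finf, e)`
    (hchain : ∀ finf : GA ((PlaneData.mixedRow q (a 0) (a 2)).withTransportedTorus g g' hgg' hg'g hgΩ) → ℂ,
      IsArchCoeffD ((PlaneData.mixedRow q (a 0) (a 2)).withTransportedTorus g g' hgg' hg'g hgΩ) (Setting.ofAdelicData ((PlaneData.mixedRow q (a 0) (a 2)).withTransportedTorus g g' hgg' hg'g hgΩ) R μ DG fdG compG compT compT') R q g g' w₀ eP eM eP' eM'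
        (γ₀ : GA ((PlaneData.mixedRow q (a 0) (a 2)).withTransportedTorus g g' hgg' hg'g hgΩ)) νinf νinf' finf →
      ∀ e : GA ((PlaneData.mixedRow q (a 0) (a 2)).withTransportedTorus g g' hgg' hg'g hgΩ) → ℂ, IsInfFactor ((PlaneData.mixedRow q (a 0) (a 2)).withTransportedTorus g g' hgg' hg'g hgΩ) e →
        (∀ (w : InfinitePlace k) (κ : GA ((PlaneData.mixedRow q (a 0) (a 2)).withTransportedTorus g g' hgg' hg'g hgΩ)), κ ∈ localTorusAt' ((PlaneData.mixedRow q (a 0) (a 2)).withTransportedTorus g g' hgg' hg'g hgΩ) w → ∀ x,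
          e (x * κ) = weightAt' ((PlaneData.mixedRow q (a 0) (a 2)).withTransportedTorus g g' hgg' hg'g hgΩ) q w g g' 0 κ ^ (-eP' w) * weightAt' ((PlaneData.mixedRow q (a 0) (a 2)).withTransportedTorus g g' hgg' hg'g hgΩ) q w g g' 1 κ ^ (-eM' w) * e x) →
        L1Class.archFactor ((PlaneData.mixedRow q (a 0) (a 2)).withTransportedTorus g g' hgg' hg'g hgΩ) R (convInf ((PlaneData.mixedRow q (a 0) (a 2)).withTransportedTorus g g' hgg' hg'g hgΩ) μinf finf e) (γ₀ : GA ((PlaneData.mixedRow q (a 0) (a 2)).withTransportedTorus g g' hgg' hg'g hgΩ)) νinf νinf' ≠ 0 →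
        ∀ M : ℕ, ChainInputs ((PlaneData.mixedRow q (a 0) (a 2)).withTransportedTorus g g' hgg' hg'g hgΩ) R γ₀ νinf νf νinf' νf' ((torusFinSplit ((PlaneData.mixedRow q (a 0) (a 2)).withTransportedTorus g g' hgg' hg'g hgΩ) (placesAbove (k := k) p)) ⁻¹' (Set.univ ×ˢ DA))
          ((Setting.ofAdelicData ((PlaneData.mixedRow q (a 0) (a 2)).withTransportedTorus g g' hgg' hg'g hgΩ) R μ DG fdG compG compT compT').conv
            (prodFn ((PlaneData.mixedRow q (a 0) (a 2)).withTransportedTorus g g' hgg' hg'g hgΩ) finf (ffinMu ((PlaneData.mixedRow q (a 0) (a 2)).withTransportedTorus g g' hgg' hg'g hgΩ) μ₀ (γ₀ : GA ((PlaneData.mixedRow q (a 0) (a 2)).withTransportedTorus g g' hgg' hg'g hgΩ)) (p ^ M))) (testNat ((PlaneData.mixedRow q (a 0) (a 2)).withTransportedTorus g g' hgg' hg'g hgΩ) e (p ^ M)))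
          (fun x => (c₀ : ℂ) * convInf ((PlaneData.mixedRow q (a 0) (a 2)).withTransportedTorus g g' hgg' hg'g hgΩ) μinf finf e x) (levelDC ((PlaneData.mixedRow q (a 0) (a 2)).withTransportedTorus g g' hgg' hg'g hgΩ) (γ₀ : GA ((PlaneData.mixedRow q (a 0) (a 2)).withTransportedTorus g g' hgg' hg'g hgΩ)) (p ^ M))) :
    ∀ finf : GA ((PlaneData.mixedRow q (a 0) (a 2)).withTransportedTorus g g' hgg' hg'g hgΩ) → ℂ,
      IsArchCoeffD ((PlaneData.mixedRow q (a 0) (a 2)).withTransportedTorus g g' hgg' hg'g hgΩ) (Setting.ofAdelicData ((PlaneData.mixedRow q (a 0) (a 2)).withTransportedTorus g g' hgg' hg'g hgΩ) R μ DG fdG compG compT compT') R q g g' w₀ eP eM eP' eM'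
        (γ₀ : GA ((PlaneData.mixedRow q (a 0) (a 2)).withTransportedTorus g g' hgg' hg'g hgΩ)) νinf νinf' finf →
      ∃ lev : ℕ → ℕ, (∀ n, lev n ≠ 0) ∧
      ∃ ffin f₂ : ℕ → GA ((PlaneData.mixedRow q (a 0) (a 2)).withTransportedTorus g g' hgg' hg'g hgΩ) → ℂ, TailFamily' ((PlaneData.mixedRow q (a 0) (a 2)).withTransportedTorus g g' hgg' hg'g hgΩ) q g g' eP' eM' (γ₀ : GA ((PlaneData.mixedRow q (a 0) (a 2)).withTransportedTorus g g' hgg' hg'g hgΩ)) ffin f₂ ∧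
        ∃ E : Finset (Setting.ofAdelicData ((PlaneData.mixedRow q (a 0) (a 2)).withTransportedTorus g g' hgg' hg'g hgΩ) R μ DG fdG compG compT compT').Orbit,
          (Setting.ofAdelicData ((PlaneData.mixedRow q (a 0) (a 2)).withTransportedTorus g g' hgg' hg'g hgΩ) R μ DG fdG compG compT compT').orbitOf γ₀ ∈ E ∧
          FibreDominatedFrom (Setting.ofAdelicData ((PlaneData.mixedRow q (a 0) (a 2)).withTransportedTorus g g' hgg' hg'g hgΩ) R μ DG fdG compG compT compT') R.chi R.chi' E
            (fun n => (Setting.ofAdelicData ((PlaneData.mixedRow q (a 0) (a 2)).withTransportedTorus g g' hgg' hg'g hgΩ) R μ DG fdG compG compT compT').conv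
              (prodFn ((PlaneData.mixedRow q (a 0) (a 2)).withTransportedTorus g g' hgg' hg'g hgΩ) finf (ffin (lev n))) (f₂ (lev n))) := by
  intro finf hfinf
  haveI : νinf'.IsMulRightInvariant := isMulRightInvariant_of_compactSpace νinf'
  have hDZf : MeasurableSet ((torusFinSplit ((PlaneData.mixedRow q (a 0) (a 2)).withTransportedTorus g g' hgg' hg'g hgΩ) (placesAbove (k := k) p)) ⁻¹' (Set.univ ×ˢ DA)) :=
    measurableSet_preimage_torusFinSplit_prod ((PlaneData.mixedRow q (a 0) (a 2)).withTransportedTorus g g' hgg' hg'g hgΩ) (placesAbove (k := k) p) MeasurableSet.univ hDA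
  -- the archimedean test of record (ARCHAPPROX through the K-type data `D`)
  obtain ⟨e, he, hequiv, harch⟩ := exists_infFactor_of_isArchCoeff ((PlaneData.mixedRow q (a 0) (a 2)).withTransportedTorus g g' hgg' hg'g hgΩ)
    (Setting.ofAdelicData ((PlaneData.mixedRow q (a 0) (a 2)).withTransportedTorus g g' hgg' hg'g hgΩ) R μ DG fdG compG compT compT') R q g g' w₀ eP eM eP' eM' (γ₀ : GA ((PlaneData.mixedRow q (a 0) (a 2)).withTransportedTorus g g' hgg' hg'g hgΩ)) νinf νinf'
    hfinf.toIsArchCoeff D μinf hc hu hc' hu'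
  have hchain' := hchain finf hfinf e he hequiv harch
  -- (S-UNIT) positivity `hv` by name (UnitBeta), at the product domain
  have hgen : IsGenuineRow ((PlaneData.mixedRow q (a 0) (a 2)).withTransportedTorus g g' hgg' hg'g hgΩ) := isGenuineRow_seesawPlane q ht hn a (ha 0) (ha 2) g g' hgg' hg'g hgΩ lam hlam hiso
  have hZ : CentreFinFinite ((PlaneData.mixedRow q (a 0) (a 2)).withTransportedTorus g g' hgg' hg'g hgΩ) := centreFinFinite_of_compactSpace_torusInf ((PlaneData.mixedRow q (a 0) (a 2)).withTransportedTorus g g' hgg' hg'g hgΩ)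
  have hprop : HasProperFinOrbit ((PlaneData.mixedRow q (a 0) (a 2)).withTransportedTorus g g' hgg' hg'g hgΩ) (γ₀ : GA ((PlaneData.mixedRow q (a 0) (a 2)).withTransportedTorus g g' hgg' hg'g hgΩ)) := hasProperFinOrbit_of_isLinRegular ((PlaneData.mixedRow q (a 0) (a 2)).withTransportedTorus g g' hgg' hg'g hgΩ) hdet hgen γ₀ hlin
  have hpM : ∀ M : ℕ, p ^ M ≠ 0 := fun M => pow_ne_zero _ hp.ne_zero
  have hv : ∀ M : ℕ, 0 < (suppMeasure ((PlaneData.mixedRow q (a 0) (a 2)).withTransportedTorus g g' hgg' hg'g hgΩ) νf νf' (γ₀ : GA ((PlaneData.mixedRow q (a 0) (a 2)).withTransportedTorus g g' hgg' hg'g hgΩ)) ((torusFinSplit ((PlaneData.mixedRow q (a 0) (a 2)).withTransportedTorus g g' hgg' hg'g hgΩ) (placesAbove (k := k) p)) ⁻¹' (Set.univ ×ˢ DA)) (p ^ M) (γ₀ : GA ((PlaneData.mixedRow q (a 0) (a 2)).withTransportedTorus g g' hgg' hg'g hgΩ))).toReal := fun M =>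
    suppMeasure_toReal_pos_of_beta ((PlaneData.mixedRow q (a 0) (a 2)).withTransportedTorus g g' hgg' hg'g hgΩ) νf νf' (γ₀ : GA ((PlaneData.mixedRow q (a 0) (a 2)).withTransportedTorus g g' hgg' hg'g hgΩ)) ((torusFinSplit ((PlaneData.mixedRow q (a 0) (a 2)).withTransportedTorus g g' hgg' hg'g hgΩ) (placesAbove (k := k) p)) ⁻¹' (Set.univ ×ˢ DA)) hDZf hfd hZ (hpM M)
      (suppMeasure_ne_top ((PlaneData.mixedRow q (a 0) (a 2)).withTransportedTorus g g' hgg' hg'g hgΩ) νf νf' (γ₀ : GA ((PlaneData.mixedRow q (a 0) (a 2)).withTransportedTorus g g' hgg' hg'g hgΩ)) ((torusFinSplit ((PlaneData.mixedRow q (a 0) (a 2)).withTransportedTorus g g' hgg' hg'g hgΩ) (placesAbove (k := k) p)) ⁻¹' (Set.univ ×ˢ DA)) hDZc (hpM M) hprop)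
  -- (S-FIN-NV) in norm form by name (L4-x2's `finnv_of_displays'`: the fibre-compactness pair drawn inside from `hdet`,
  -- `hgen`, `hlin`, `hDZc`), `hint`/`hB` from `ChainInputs`
  have hnv := finnv_of_displays' ((PlaneData.mixedRow q (a 0) (a 2)).withTransportedTorus g g' hgg' hg'g hgΩ) R hc hu hc' hu' hdet hgen γ₀ hlin p hp.ne_zero νf νf' νA νA' DA hDA hfd hDZc haway hv
    (fun M => (hchain' M).hIfin) (fun M => (hchain' M).hB)
  exact tailForArch_seesaw_of_pieces_full q ht hn a ha g g' hgg' hg'g hgΩ lam hlam hiso hdet R hRH hc hu hc' hu' w₀ eP eM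
    eP' eM' D μ DG fdG compG compT compT' γ₀ hlin νinf νf c hc0 hcμ νinf' νf' c' hc0' hcμ' _ hDZf hfd hDZc μinf μ₀ c₀ hc₀
    hcμ₀ p hp hγ₀ u κ hκ hproj M₃ hM₃ hcur hcount hnv hchain finf hfinf

end FinNV

end Summit.Ventures.HodgeRepro.Tier4.Line4

end
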